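import Summits.ABC.StewartYu.PadicG3TwoSlabFunctions
import HarnessLib

/-!
# Cell abc-stewartyu, Gen-3 frame at `p = 2` (crux `Y07Two`, stmt-ABC-19659), F5 support: the SLAB SURVIVES THE
# `3`-DESCENT RE-INDEXING `u = 3u′ + v` (same class `v` for the whole family)

`Summits/ABC/StewartYu/PadicG3TwoSlabReindex.lean` — cell `abc-stewartyu` (HOME `run/shared/lean/pub/abc-stewartyu/`),
route `PadicPrimesKummerThird`, seat p3 (g5), F-two LEAD; consumed by F5 (`PadicG3TwoThirdStep`, p4-g3).
Theorems on `TwoSetup`.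

After the Kummer `3`-descent at a third point, the surviving class `v = (v, v_θ) (mod 3)` of exponent vectors is
re-indexed by `uᵢ = 3·uᵢ′ + v`, `u_θᵢ = 3·u_θᵢ′ + v_θ` (memo-09 §7 F5).  The exponents are affine in `u`:
`zψ(u) = 3·zψ(u′) + zψ(v)` and `zexpo(u) = 3·zexpo(u′) + zexpo(v)` (`zψ_reindex3`, `zexpo_reindex3`), hence the
exponent DIFFERENCES of the new family are `δ′ = 3⁻¹·δ` (`δexpo_reindex3`) and, `3` being a `2`-adic unit,
`‖δ′‖ = ‖δ‖` (`norm_δexpo_reindex3`): the slab hypothesis `‖δexpo i₀ i‖ ≤ 2^{−(m+3)}` of the slab layers passes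
to the next level UNCHANGED (`slab_reindex3`).

WHAT THIS IS NOT: not the third step itself; no crux moves.

References: K. Yu, Acta Math. 211 (2013), Lemma 5.4, (5.1)(i); K. Yu, Compositio Math. 74 (1990), §3.
-/

noncomputable section

open Finset NormedSpace
open Literature.NumberTheory.Transcendental

namespace Summit.ABC.StewartYu

namespace TwoSetup

variable (S : TwoSetup) {ι : Type*}

/-- `zψ(3u′ + v) = 3·zψ(u′) + zψ(v)`. [folklore] -/
theorem zψ_reindex3 (u' v : Fin S.d → ℤ) (uθ' vθ : ℤ) :
    S.zψ (fun j => 3 * u' j + v j) (3 * uθ' + vθ) = 3 * S.zψ u' uθ' + S.zψ v vθ := by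
  unfold zψ
  push_cast
  have e : ∑ x, (3 * (u' x : ℚ_[2]) + (v x : ℚ_[2])) * S.lg x =
      3 * ∑ j, (u' j : ℚ_[2]) * S.lg j + ∑ j, (v j : ℚ_[2]) * S.lg j := by
    rw [Finset.mul_sum, ← Finset.sum_add_distrib]
    exact Finset.sum_congr rfl fun j _ => by ring
  rw [e]
  ring

/-- `zexpo(3u′ + v) = 3·zexpo(u′) + zexpo(v)`. [folklore] -/
theorem zexpo_reindex3 (u' v : Fin S.d → ℤ) (uθ' vθ : ℤ) :
    S.zexpo (fun j => 3 * u' j + v j) (3 * uθ' + vθ) = 3 * S.zexpo u' uθ' + S.zexpo v vθ := by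
  rw [S.zexpo_eq, S.zexpo_eq, S.zexpo_eq, S.zψ_reindex3]
  push_cast
  ring

variable (u' : ι → Fin S.d → ℤ) (uθ' : ι → ℤ) (v : Fin S.d → ℤ) (vθ : ℤ)

/-- **The exponent differences after re-indexing**: if the old family is `uᵢ = 3uᵢ′ + v` (one class `v`),
then `δexpo(old) = 3·δexpo(new)`. [cite: Yu2013, Lemma 5.4; shape only] -/
theorem δexpo_reindex3 (i₀ i : ι) :
    S.δexpo (fun i => fun j => 3 * u' i j + v j) (fun i => 3 * uθ' i + vθ) i₀ i =
      3 * S.δexpo u' uθ' i₀ i := by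
  unfold δexpo
  rw [S.zexpo_reindex3 (u' i) v (uθ' i) vθ, S.zexpo_reindex3 (u' i₀) v (uθ' i₀) vθ]
  ring

/-- `‖3‖₂ = 1`. [folklore] -/
theorem norm_three_two : ‖(3 : ℚ_[2])‖ = 1 := by
  have h := TwoAdic.norm_inv_three_two
  have h3 : ((3 : ℕ) : ℚ_[2]) = 3 := by norm_num
  rw [h3, norm_inv] at h
  exact inv_eq_one.mp h

/-- **`‖δexpo(new)‖ = ‖δexpo(old)‖`** (`3` is a `2`-adic unit). [folklore] -/
theorem norm_δexpo_reindex3 (i₀ i : ι) :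
    ‖S.δexpo u' uθ' i₀ i‖ =
      ‖S.δexpo (fun i => fun j => 3 * u' i j + v j) (fun i => 3 * uθ' i + vθ) i₀ i‖ := by
  rw [S.δexpo_reindex3, norm_mul, norm_three_two, one_mul]

/-- **The slab passes to the next level**: the slab hypothesis for the old family (class `v`) is the slab
hypothesis for the re-indexed family, with the same base point, depth and bound.
[cite: Yu2013, Lemma 5.4 and (5.1)(i); shape only] -/
theorem slab_reindex3 (B : Finset ι) (i₀ : ι) {ε : ℝ}
    (hslab : ∀ i ∈ B, ‖S.δexpo (fun i => fun j => 3 * u' i j + v j) (fun i => 3 * uθ' i + vθ) i₀ i‖ ≤ ε) :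
    ∀ i ∈ B, ‖S.δexpo u' uθ' i₀ i‖ ≤ ε := by
  intro i hi
  rw [S.norm_δexpo_reindex3 u' uθ' v vθ i₀ i]
  exact hslab i hi

end TwoSetup

end Summit.ABC.StewartYu

end
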